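import Summits.NavierStokesRegularity.Statement
import Literature.Analysis.FluidPDE.NSKatoToClayHolds
import Literature.Analysis.FluidPDE.NSCriticalClosureBesovKatoClass
import Literature.Analysis.FluidPDE.NSLocalClassicalProofs
import Literature.Analysis.FluidPDE.KatoLerayHopf
import Literature.Analysis.FluidPDE.RusinSverakKatoBoundHolds
import Literature.Analysis.FluidPDE.NSWeakStrongUniquenessHolds
import Literature.Analysis.FluidPDE.NSLerayExistenceR3Holds
import Literature.Analysis.FluidPDE.KatoFarFieldBound
import Literature.Analysis.FluidPDE.LerayLocalRegularH1Proofs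
import Literature.Analysis.FluidPDE.KatoMaximalTimeSingular
import Literature.Analysis.FluidPDE.NSCriticalClosureBesovBounded
import Literature.Analysis.FluidPDE.WeakSolutionWeakContinuity
import Literature.Analysis.FluidPDE.MildL3SmoothHolds
import Literature.Analysis.FluidPDE.KatoL3Uniqueness
import Literature.Analysis.FluidPDE.TaoLocalisationHolds
import Literature.Analysis.FluidPDE.SereginSverak2002PressureLowerBound
import HarnessLib

/-!
# Route FrozenSignCascade · crux `BoundedEnvelopeContinuation` — stub E `stub_clayOfBackwardBounded`

Helper file for the crux item stmt-NavierStokesRegularity-10579 (`BoundedEnvelopeContinuation`,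
conjunct (B) of route `FrozenSignCascade`, line `registered`); lands `--supports` that item.

**Statement (per-datum version of item 0055, `Theorems/NoBlowupToClay.lean`).** For `ν > 0` and a
smooth, divergence-free, rapidly decaying datum `u₀`: if every classical solution `(u, p)` of the
unforced Navier–Stokes system on `ℝ³ × [0, T)` which is a Leray–Hopf weak solution on `[0, T]` from
`u₀` with `u 0 = u₀` is backward bounded (`IsBackwardBoundedAt u T x₀`: bounded on some backward
cylinder `(T - r², T) × B_r(x₀)`) at every final-time point `(T, x₀)`, then `u₀` launches a global
smooth solution with bounded energy (Fefferman's (A) for that datum).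

Proof: as for item 0055 (steps 1–6 of the docstring of `Theorems/NoBlowupToClay.lean`), with the
no-blow-up hypothesis replaced by backward boundedness. If Kato's maximal time `T` of `u₀` were
finite, the maximal Kato solution has a classical representative `Ũ` on `[0, T)`, Leray–Hopf on
`[0, T]` from `u₀` (through Leray's weak solution and weak–strong uniqueness), hence backward
bounded at the singular point `(T, x₀)` given by Lemarié-Rieusset 2016, Thm. 15.1 (C)
(`lemarieRieusset_singular_point_of_blowup_holds`), where `Ũ ∉ L^∞(Q_r(T, x₀))` for every small
`r` — absurd. So `T_max = ∞` and `clay_solution_of_hasGlobalKatoSolution_holds` (von Wahl;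
Lemarié-Rieusset 2016, Prop. 12.3) gives the Clay solution. Every analytic input is a theorem of
the tree.

References: Leray 1934; Kato 1984 (Thms. 1, 4); Lemarié-Rieusset 2016 (Thm. 15.1, Prop. 12.3);
Escauriaza–Seregin–Šverák 2003 (Rem. 7.5); Serrin 1963 / Prodi 1959; Tao 2013 (Cor. 11.1).
-/

noncomputable section

set_option linter.dupNamespace false -- nested layout Summit.<S>.<Sub>, Sub = S (D-0017)

open MeasureTheory TopologicalSpace Set Function Filter Metric
open _root_.Topology
open scoped ENNReal NNReal RealInnerProductSpace
open Literature.Analysis.FluidPDE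

namespace Summit.NavierStokesRegularity.NavierStokesRegularity.Theorems.BoundedEnvelope

-- adapted from Summits/NavierStokesRegularity/NavierStokesRegularity/Theorems/NoBlowupToClay.lean
-- (navierStokesRegularity_of_noBlowup, item 0055)
/-- **Stub E of the crux `BoundedEnvelopeContinuation` (item 0055 for one datum): backward
boundedness of every classical Leray–Hopf solution from `u₀` at every final-time point implies a
global smooth bounded-energy solution from `u₀`.** Kato's maximal time of `u₀` is infinite: at a
finite maximal time `T` the glued classical Leray–Hopf representative `Ũ` of the maximal Kato
solution on `[0, T)` is Leray–Hopf on `[0, T]` from `u₀`, so backward bounded at the singular point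
`(T, x₀)` of Lemarié-Rieusset's Thm. 15.1 (C), where `Ũ` is essentially unbounded on every small
parabolic cylinder — absurd; then `clay_solution_of_hasGlobalKatoSolution_holds` (von Wahl;
Lemarié-Rieusset 2016, Prop. 12.3; Kato 1984, Thm. 4) gives `(u, p)`.
[cite: LemarieRieusset2016, Thm. 15.1 (C) and Prop. 12.3] -/
theorem stub_clayOfBackwardBounded :
    ∀ ν : ℝ, 0 < ν → ∀ (u₀ : EuclideanSpace ℝ (Fin 3) → EuclideanSpace ℝ (Fin 3))
      (hu : ContDiff ℝ (⊤ : ℕ∞) u₀) (hd : Literature.Analysis.FluidPDE.HasRapidSpatialDecay u₀),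
      Literature.Analysis.FluidPDE.NSWave0.IsDivFree u₀ →
      (∀ T : ℝ, 0 < T → ∀ (u : ℝ → EuclideanSpace ℝ (Fin 3) → EuclideanSpace ℝ (Fin 3))
          (p : ℝ → EuclideanSpace ℝ (Fin 3) → ℝ),
          Literature.Analysis.FluidPDE.IsClassicalNSSolutionOn (Set.Ico 0 T) ν 0 u p →
          Literature.Analysis.FluidPDE.IsLerayHopfOn T ν 0 u₀ u → u 0 = u₀ →
          ∀ x₀ : EuclideanSpace ℝ (Fin 3), Literature.Analysis.FluidPDE.IsBackwardBoundedAt u T x₀) →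
      ∃ (u : ℝ → EuclideanSpace ℝ (Fin 3) → EuclideanSpace ℝ (Fin 3))
        (p : ℝ → EuclideanSpace ℝ (Fin 3) → ℝ),
        Literature.Analysis.FluidPDE.IsSmoothOnHalfSpace u ∧
        Literature.Analysis.FluidPDE.IsSmoothOnHalfSpace p ∧
        Literature.Analysis.FluidPDE.IsNavierStokesSolution ν 0 u₀ u p ∧
        Literature.Analysis.FluidPDE.HasBoundedEnergy u := by
  intro ν hν u₀ hsm hdec hdiv hBB
  -- ### (0) two elementary tools
  -- (a) resetting the junk initial slice of a Leray–Hopf solution to the datum keeps it Leray–Hopf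
  have hupd : ∀ {T : ℝ} {u : ℝ → EuclideanSpace ℝ (Fin 3) → EuclideanSpace ℝ (Fin 3)},
      IsLerayHopfOn T ν 0 u₀ u → MemLp u₀ 2 volume → IsLerayHopfOn T ν 0 u₀ (Function.update u 0 u₀) := by
    intro T u hu hu₀
    set v : ℝ → EuclideanSpace ℝ (Fin 3) → EuclideanSpace ℝ (Fin 3) := Function.update u 0 u₀ with hv
    have hvt : ∀ t : ℝ, t ≠ 0 → v t = u t := fun t ht => Function.update_of_ne ht _ _
    have hv0 : v 0 = u₀ := Function.update_self _ _ _
    have hIoo : ∀ᵐ t ∂(volume.restrict (Ioo (0 : ℝ) T)), v t = u t := by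
      filter_upwards [ae_restrict_mem measurableSet_Ioo] with t ht
      exact hvt t ht.1.ne'
    obtain ⟨G, hG, hGint, h0, hs⟩ := hu.weakGrad_energy
    refine
      { weak := hu.weak.congr_ae_slice hIoo
        energy_bound := ?_
        memLp := fun t ht => ?_
        weakGrad_energy := ⟨G, ?_, hGint, fun t ht => ?_, ?_⟩
        weak_continuous := fun w hw => ?_
        strong_initial := ?_ }
    · obtain ⟨C, hC⟩ := hu.energy_bound
      refine ⟨C, ?_⟩
      filter_upwards [hC, hIoo] with t ht hvu
      rwa [hvu]
    · rcases eq_or_ne t 0 with rfl | ht0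
      · rw [hv0]; exact hu₀
      · rw [hvt t ht0]; exact hu.memLp t ht
    · filter_upwards [hG, hIoo] with t ht hvu
      rwa [hvu]
    · rcases eq_or_ne t 0 with rfl | ht0
      · simp only [hv0, Ioo_self, Measure.restrict_empty, lintegral_zero_measure,
          ENNReal.toReal_zero, mul_zero, add_zero, Pi.zero_apply, inner_zero_left, integral_zero,
          intervalIntegral.integral_zero, le_refl]
      · have h1 := h0 t ht
        simp only [Pi.zero_apply, inner_zero_left, integral_zero, intervalIntegral.integral_zero,
          add_zero] at h1 ⊢
        rwa [hvt t ht0]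
    · filter_upwards [hs, ae_restrict_mem measurableSet_Ioo] with s hs' hsI
      intro t ht
      have ht0 : t ≠ 0 := (hsI.1.trans_le ht.1).ne'
      have h1 := hs' t ht
      simp only [Pi.zero_apply, inner_zero_left, integral_zero, intervalIntegral.integral_zero,
        add_zero] at h1 ⊢
      rwa [hvt t ht0, hvt s hsI.1.ne']
    · obtain ⟨hc, ht⟩ := hu.weak_continuous w hw
      refine ⟨hc.congr fun t ht' => ?_, ht.congr' ?_⟩
      · simp only [hvt t ht'.1.ne']
      · filter_upwards [self_mem_nhdsWithin] with t ht'
        simp only [hvt t (ne_of_gt ht')]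
    · refine hu.strong_initial.congr' ?_
      filter_upwards [self_mem_nhdsWithin] with t ht'
      simp only [hvt t (ne_of_gt ht')]
  -- (b) an a.e. inequality between continuous functions on an open space–time set holds everywhere
  have hforall : ∀ {O : Set (ℝ × EuclideanSpace ℝ (Fin 3))}, IsOpen O →
      ∀ {f g : ℝ × EuclideanSpace ℝ (Fin 3) → ℝ}, ContinuousOn f O → ContinuousOn g O →
        (∀ᵐ z ∂(volume.restrict O), f z ≤ g z) → ∀ z ∈ O, f z ≤ g z := by
    intro O hO f g hf hg h
    have hopen : IsOpen (O ∩ (fun z => (g z, f z)) ⁻¹' {p : ℝ × ℝ | p.1 < p.2}) :=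
      (hg.prodMk hf).isOpen_inter_preimage hO (isOpen_lt continuous_fst continuous_snd)
    have hnull : volume (O ∩ (fun z => (g z, f z)) ⁻¹' {p : ℝ × ℝ | p.1 < p.2}) = 0 := by
      rw [ae_iff, Measure.restrict_apply' hO.measurableSet] at h
      rw [inter_comm]
      simpa only [not_le, preimage_setOf_eq] using h
    have hempty := (hopen.measure_eq_zero_iff volume).1 hnull
    intro z hz
    by_contra hlt
    have hmem : z ∈ O ∩ (fun z => (g z, f z)) ⁻¹' {p : ℝ × ℝ | p.1 < p.2} := ⟨hz, not_le.1 hlt⟩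
    rw [hempty] at hmem
    exact hmem
  -- ### it suffices that Kato's maximal time of the datum is infinite
  suffices htop : katoMaximalTime ν u₀ = ⊤ from
    clay_solution_of_hasGlobalKatoSolution_holds ν hν u₀ hsm hdiv hdec
      (hasGlobalKatoSolution_of_katoMaximalTime_eq_top kato_unique_holds hν htop)
  -- ### (1) the local classical Leray–Hopf solution and the datum
  obtain ⟨T₀, hT₀, v, q, hv, hv0, hvLH⟩ := local_classical_lerayHopf_holds ν hν u₀ hsm hdiv hdec
  have hvLH' : IsLerayHopfOn T₀ ν 0 (v 0) v := by rw [hv0]; exact hvLH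
  have hdecv : HasRapidSpatialDecay (v 0) := by rw [hv0]; exact hdec
  have hu₀2 : MemLp u₀ 2 volume := by
    have h := hvLH.memLp 0 ⟨le_rfl, hT₀.le⟩
    rwa [hv0] at h
  have hdiv0 : IsWeaklyDivFree u₀ := hvLH.isWeaklyDivFree_datum hT₀
  have hvK : IsKatoSolutionOn T₀ ν u₀ v := by
    have h := isKatoSolutionOn_of_classical hν hT₀ hv hvLH' hdecv
    rwa [hv0] at h
  have hu₀3 : MemLp u₀ 3 volume := hvK.memLp_initial hT₀
  -- ### (2) Kato's maximal time
  by_contra htop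
  set Tm : ℝ≥0∞ := katoMaximalTime ν u₀ with hTm_def
  have hT₀le : ENNReal.ofReal T₀ ≤ Tm := hvK.ofReal_le_katoMaximalTime
  have hTm_lt : Tm < ⊤ := lt_top_iff_ne_top.2 htop; have hTm_pos : 0 < Tm := (ENNReal.ofReal_pos.2 hT₀).trans_le hT₀le
  set T : ℝ := Tm.toReal with hT_def
  have hTeq : ENNReal.ofReal T = Tm := ENNReal.ofReal_toReal htop
  have hT₀T : T₀ ≤ T := by
    have h : ENNReal.ofReal T₀ ≤ ENNReal.ofReal T := by rw [hTeq]; exact hT₀le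
    exact (ENNReal.ofReal_le_ofReal_iff ENNReal.toReal_nonneg).1 h
  have hTpos : 0 < T := hT₀.trans_le hT₀T
  obtain ⟨κ, hκ⟩ := exists_isKatoSolutionOn_katoMaximalTime kato_unique_holds hν hTm_pos hTm_lt
  have hmax : ∀ T' : ℝ, T < T' →
      ∀ z : ℝ → EuclideanSpace ℝ (Fin 3) → EuclideanSpace ℝ (Fin 3), ¬ IsKatoSolutionOn T' ν u₀ z :=
    fun T' hT' z => not_isKatoSolutionOn_of_katoMaximalTime_lt (by
      rw [← hTm_def, ← hTeq]
      exact (ENNReal.ofReal_lt_ofReal_iff (hTpos.trans hT')).2 hT')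
  -- ### (3) the classical representative `U` of `κ` on `[0, T)`
  obtain ⟨w, ϖ, hw, hwκ⟩ := mild_L3_smooth_holds hν hTpos hu₀3 hdiv0 hκ.mild hκ.continuousInLpOn
    hκ.aestronglyMeasurable
  have hvκ : ∀ t ∈ Ico 0 T₀, v t =ᵐ[volume] κ t := fun t ht =>
    IsKatoSolutionOn.ae_eq kato_unique_holds hν hvK hκ ht.1 ht.2 (ht.2.trans_le hT₀T)
  have hvw : ∀ t ∈ Ioo 0 T₀, v t = w t := by
    intro t ht
    have h1 : v t =ᵐ[volume] w t :=
      (hvκ t ⟨ht.1.le, ht.2⟩).trans (hwκ t ⟨ht.1, ht.2.trans_le hT₀T⟩).symm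
    exact (Continuous.ae_eq_iff_eq volume (hv.contDiff_velocity ⟨ht.1.le, ht.2⟩).continuous
      (hw.contDiff_velocity ⟨ht.1, ht.2.trans_le hT₀T⟩).continuous).1 h1
  have hU := hv.glue hw le_rfl hT₀ hT₀T hvw
  set U : ℝ → EuclideanSpace ℝ (Fin 3) → EuclideanSpace ℝ (Fin 3) :=
    fun t => if t < T₀ then v t else w t with hU_def
  set P : ℝ → EuclideanSpace ℝ (Fin 3) → ℝ :=
    fun t => if t < T₀ then (fun x => q t x - q t 0) else fun x => ϖ t x - ϖ t 0 with hP_def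
  have hU0 : U 0 = u₀ := by simp only [hU_def, hT₀, if_true, hv0]
  have hUκ : ∀ t ∈ Ico 0 T, U t =ᵐ[volume] κ t := by
    intro t ht
    by_cases htT₀ : t < T₀
    · simp only [hU_def, htT₀, if_true]
      exact hvκ t ⟨ht.1, htT₀⟩
    · simp only [hU_def, htT₀, if_false]
      exact hwκ t ⟨hT₀.trans_le (not_lt.1 htT₀), ht.2⟩
  have hUcont : ContinuousOn (uncurry U) (Ico 0 T ×ˢ univ) := hU.smooth_velocity.continuousOn
  have hUmeas : ∀ S : ℝ, S ≤ T →
      AEStronglyMeasurable (uncurry U) (volume.restrict (Ioo 0 S ×ˢ univ)) := fun S hS =>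
    (hUcont.mono (prod_mono (Ioo_subset_Ico_self.trans (Ico_subset_Ico_right hS))
      Subset.rfl)).aestronglyMeasurable (measurableSet_Ioo.prod MeasurableSet.univ)
  -- ### (4) Kato's smoothing bound, pointwise for `U`
  have hbound : ∀ S : ℝ, 0 < S → S < T → ∃ C : ℝ, 0 ≤ C ∧
      ∀ t ∈ Ioo 0 S, ∀ x, ‖U t x‖ ≤ C / Real.sqrt t := by
    intro S hS0 hST
    obtain ⟨C, hC⟩ := kato_solution_le_div_sqrt_holds ν T u₀ κ hν hκ S hS0 hST
    have hκS : AEStronglyMeasurable (uncurry κ) (volume.restrict (Ioo 0 S ×ˢ univ)) :=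
      hκ.aestronglyMeasurable.mono_measure
        (Measure.restrict_mono (prod_mono (Ioo_subset_Ioo_right hST.le) Subset.rfl) le_rfl)
    have hae : uncurry κ =ᵐ[volume.restrict (Ioo 0 S ×ˢ univ)] uncurry U :=
      ae_restrict_prod_of_forall_ae_eq (fun t ht => (hUκ t ⟨ht.1.le, ht.2.trans hST⟩).symm) hκS
        (hUmeas S hST.le)
    have hC' : ∀ᵐ z ∂(volume.restrict (Ioo 0 S ×ˢ (univ : Set (EuclideanSpace ℝ (Fin 3))))),
        ‖uncurry U z‖ ≤ |C| / Real.sqrt z.1 := by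
      filter_upwards [hC, hae] with z hz hzU
      calc ‖uncurry U z‖ = ‖κ z.1 z.2‖ := by rw [← hzU]; rfl
        _ ≤ C / Real.sqrt z.1 := hz
        _ ≤ |C| / Real.sqrt z.1 := by gcongr; exact le_abs_self C
    have hO : IsOpen (Ioo (0 : ℝ) S ×ˢ (univ : Set (EuclideanSpace ℝ (Fin 3)))) := isOpen_Ioo.prod isOpen_univ
    have hf : ContinuousOn (fun z : ℝ × EuclideanSpace ℝ (Fin 3) => ‖uncurry U z‖)
        (Ioo 0 S ×ˢ univ) :=
      (hUcont.mono (prod_mono (Ioo_subset_Ico_self.trans (Ico_subset_Ico_right hST.le))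
        Subset.rfl)).norm
    have hg : ContinuousOn (fun z : ℝ × EuclideanSpace ℝ (Fin 3) => |C| / Real.sqrt z.1)
        (Ioo 0 S ×ˢ univ) := by
      exact continuousOn_const.div (Real.continuous_sqrt.comp_continuousOn continuousOn_fst)
        fun z hz => (Real.sqrt_pos.2 hz.1.1).ne'
    exact ⟨|C|, abs_nonneg C, fun t ht x =>
      hforall hO hf hg hC' (t, x) ⟨ht, mem_univ x⟩⟩
  -- ### (5) the bound of `v` on `[0, T₀/2]` (Tao 2013, Cor. 11.1)
  obtain ⟨M₁, hM₁⟩ := exists_forall_norm_le_of_tao2011 tao2011_hasBoundedSobolevNormsOn_holds hν hv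
    hvLH' hdecv (T₀ / 2) ⟨half_pos hT₀, half_lt_self hT₀⟩
  -- ### (6) `κ` is Leray–Hopf on `[0, S']` and agrees with Leray's weak solution
  obtain ⟨uL, huL⟩ := leray_existence_R3_holds ν hν u₀ hu₀2 hdiv0
  have hLae : ∀ t ∈ Ioo 0 T, uL t =ᵐ[volume] U t := by
    intro t ht
    set S' : ℝ := (t + T) / 2 with hS'_def  -- horizons `t < S' < S < T`
    set S : ℝ := (S' + T) / 2 with hS_def
    have htS' : t < S' := by rw [hS'_def]; linarith [ht.2]
    have hS'T : S' < T := by rw [hS'_def]; linarith [ht.2]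
    have hS'0 : 0 < S' := ht.1.trans htS'
    have hS'S : S' < S := by rw [hS_def]; linarith
    have hST : S < T := by rw [hS_def]; linarith
    obtain ⟨C, hC0, hC⟩ := hbound S (hS'0.trans hS'S) hST
    -- Kato's smoothing hypothesis on `(0, S)` for `κ`
    have hinf : ∀ s ∈ Ioo 0 S, eLpNorm (κ s) ∞ volume ≤ ENNReal.ofReal (C / Real.sqrt s) := by
      intro s hs
      rw [eLpNorm_congr_ae (hUκ s ⟨hs.1.le, hs.2.trans hST⟩).symm, eLpNorm_exponent_top]
      exact eLpNormEssSup_le_of_ae_bound (Eventually.of_forall fun x => hC s hs x)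
    have hκLH : IsLerayHopfOn S' ν 0 u₀ κ :=
      ((hκ.mono hST.le).isLerayHopfOn_of_memLp_two hν hu₀2 hinf hS'S hS'0).1
    -- Serrin's class `L^∞(0, S'; L^∞)`
    set M : ℝ := max M₁ (C / Real.sqrt (T₀ / 2)) with hM_def
    have hUM : ∀ s ∈ Ioo 0 S', ∀ x, ‖U s x‖ ≤ M := by
      intro s hs x
      by_cases hs2 : s ≤ T₀ / 2
      · have hsT₀ : s < T₀ := hs2.trans_lt (half_lt_self hT₀)
        have hUs : U s = v s := by simp only [hU_def, hsT₀, if_true]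
        rw [hUs]
        exact (hM₁ s ⟨hs.1.le, hs2⟩ x).trans (le_max_left _ _)
      · push Not at hs2
        have h1 : ‖U s x‖ ≤ C / Real.sqrt s := hC s ⟨hs.1, hs.2.trans hS'S⟩ x
        have h2 : C / Real.sqrt s ≤ C / Real.sqrt (T₀ / 2) := by
          apply div_le_div_of_nonneg_left hC0 (Real.sqrt_pos.2 (half_pos hT₀))
          exact Real.sqrt_le_sqrt hs2.le
        exact (h1.trans h2).trans (le_max_right _ _)
    have hSerrin : MemLqLp ∞ ∞ κ (Ioo 0 S') := by
      refine memLqLp_of_ae_eLpNorm_le (C := ENNReal.ofReal M) ENNReal.ofReal_ne_top ?_ ?_ ?_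
      · rw [Real.volume_Ioo]; exact ENNReal.ofReal_ne_top
      · refine (ae_restrict_iff' measurableSet_Ioo).2 (Eventually.of_forall fun s hs => ?_)
        exact memLp_top_of_bound (hκ.memLp ⟨hs.1.le, hs.2.trans hS'T⟩).1 M
          ((hUκ s ⟨hs.1.le, hs.2.trans hS'T⟩).mono fun x hx => by rw [← hx]; exact hUM s hs x)
      · refine (ae_restrict_iff' measurableSet_Ioo).2 (Eventually.of_forall fun s hs => ?_)
        rw [eLpNorm_congr_ae (hUκ s ⟨hs.1.le, hs.2.trans hS'T⟩).symm, eLpNorm_exponent_top]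
        exact eLpNormEssSup_le_of_ae_bound (Eventually.of_forall fun x => hUM s hs x)
    -- weak–strong uniqueness on `[0, S']`
    have hqr : 2 / (∞ : ℝ≥0∞) + 3 / (∞ : ℝ≥0∞) ≤ 1 := by simp [ENNReal.div_top]
    exact (weak_strong_uniqueness_holds hν hS'0 hκLH ENNReal.ofNat_lt_top hqr hSerrin
      (huL.isLerayHopfOn hS'0) t ⟨ht.1, htS'.le⟩).trans (hUκ t ⟨ht.1.le, ht.2⟩).symm
  -- ### (7) the velocity `Ũ`, Leray–Hopf on `[0, T]`
  set uL' : ℝ → EuclideanSpace ℝ (Fin 3) → EuclideanSpace ℝ (Fin 3) := Function.update uL 0 u₀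
    with huL'_def
  have huL'LH : IsLerayHopfOn T ν 0 u₀ uL' := hupd (huL.isLerayHopfOn hTpos) hu₀2
  set Ut : ℝ → EuclideanSpace ℝ (Fin 3) → EuclideanSpace ℝ (Fin 3) :=
    fun t => if t < T then U t else uL' t with hUt_def
  have hUtU : ∀ t ∈ Ico 0 T, Ut t = U t := fun t ht => by simp only [hUt_def, ht.2, if_true]
  have hUtcl : IsClassicalNSSolutionOn (Ico 0 T) ν 0 Ut P := hU.congr_slices hUtU fun _ _ => rfl
  have hUt0 : Ut 0 = u₀ := by rw [hUtU 0 ⟨le_rfl, hTpos⟩, hU0]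
  have hUtmeas : AEStronglyMeasurable (uncurry Ut) (volume.restrict (Ioo 0 T ×ˢ univ)) := by
    refine (hUmeas T le_rfl).congr ?_
    filter_upwards [ae_restrict_mem (measurableSet_Ioo.prod MeasurableSet.univ)] with z hz
    change U z.1 z.2 = Ut z.1 z.2
    rw [hUtU z.1 ⟨hz.1.1.le, hz.1.2⟩]
  have hUtLH : IsLerayHopfOn T ν 0 u₀ Ut := by
    refine huL'LH.congr_ae_slices hTpos hUtmeas fun t ht => ?_
    by_cases htT : t < T
    · rw [hUtU t ⟨ht.1, htT⟩]
      rcases ht.1.eq_or_lt with h0 | h0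
      · rw [← h0, hU0, huL'_def, Function.update_self]
      · rw [huL'_def, Function.update_of_ne h0.ne']
        exact (hLae t ⟨h0, htT⟩).symm
    · simp only [hUt_def, htT, if_false]
      exact EventuallyEq.rfl
  have hUtLH' : IsLerayHopfOn T ν 0 (Ut 0) Ut := by rw [hUt0]; exact hUtLH
  have hdecUt : HasRapidSpatialDecay (Ut 0) := by rw [hUt0]; exact hdec
  -- ### (8) `Ũ` is a Kato solution with maximal lifespan: a singular point `(T, x₀)`
  have hUtK : IsKatoSolutionOn T ν u₀ Ut := by
    have h := isKatoSolutionOn_of_classical hν hTpos hUtcl hUtLH' hdecUt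
    rwa [hUt0] at h
  obtain ⟨x₀, hx₀⟩ := lemarieRieusset_singular_point_of_blowup_holds hν hTpos hu₀3 hdiv0 hUtK hmax
  -- ### (9) `Ũ` is backward bounded at `(T, x₀)`: contradiction
  obtain ⟨ρ, hρ, Cb, hCb⟩ := hBB T hTpos Ut P hUtcl hUtLH hUt0 x₀
  set r : ℝ := min ρ (Real.sqrt T / 2) with hr_def
  have hsqT : 0 < Real.sqrt T := Real.sqrt_pos.2 hTpos
  have hr : 0 < r := lt_min hρ (by positivity)
  have hrρ : r ≤ ρ := min_le_left _ _
  have hrT : r ^ 2 < T := by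
    have h1 : r ≤ Real.sqrt T / 2 := min_le_right _ _
    have h2 : r ^ 2 ≤ (Real.sqrt T / 2) ^ 2 := pow_le_pow_left₀ hr.le h1 2
    have h3 : (Real.sqrt T / 2) ^ 2 = T / 4 := by rw [div_pow, Real.sq_sqrt hTpos.le]; norm_num
    linarith
  have hρ2 : r ^ 2 ≤ ρ ^ 2 := pow_le_pow_left₀ hr.le hrρ 2
  have hbd : ∀ᵐ z ∂(volume.restrict (parabolicCylinder r ((T : ℝ), x₀))), ‖uncurry Ut z‖ ≤ Cb := by
    filter_upwards [ae_restrict_mem (measurableSet_Ioo.prod measurableSet_ball)] with z hz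
    exact hCb z.1 ⟨by linarith [hz.1.1], hz.1.2⟩ z.2 (ball_subset_ball hrρ hz.2)
  exact (eLpNorm_exponent_top (f := uncurry Ut) ▸ eLpNormEssSup_lt_top_of_ae_bound hbd).ne
    (hx₀ r hr hrT)

end Summit.NavierStokesRegularity.NavierStokesRegularity.Theorems.BoundedEnvelope

end
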